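/-
Copyright: the b2b-balaban T⁴-continuum CRUX team, row NE7b OWNER lineage `t4-ne7b-p1` (gen 146). Project licence.
-/
import Summits.QuantumFields.BalabanUV.T4Continuum.Spine.NE7b.SupFifthKernelEntryGroupFour
import Summits.QuantumFields.BalabanUV.T4Continuum.Spine.NE7b.SupInterpolatedFifthPieces
import Summits.QuantumFields.BalabanUV.T4Continuum.Spine.NE7b.SupInterpolatedFifthTreePieces

/-!
# THE INTERPOLATED ORDER-FIVE ENTRY MAJORANT, GROUP FOUR (SCOPING-d17 §F, F12 = (608)′).  (608) bounds the two halves of the centred-triple group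
# by twelve placements each: supported `U‴`-vertex triples, supported two-rider triples and supported Hessian-vertex trees.  THIS FILE restates both
# halves with EVERY supported term INTERPOLATED and the trees under the full-graph product of the slower kernel `r₁` ((678), (680)):
# `√(2K3√M₁C3k)∕√(ρρ)`, `√(4HkHk√√M₁C3h)∕√(ρρ)`, `√(16·8Hk√M₁√√M₁C4)·Π_{6 pairs}r₁⁻¹` — NO support indicator anywhere; proof = (608)'s with the piece
# lemmas swapped call for call (new hypotheses: the four `r₁` letters and `0 ≤ C4`) (row NE7b, node U5c; (608), (678), (680) BY NAME; [folklore]).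

Cell `pub-balaban`, sub-cell `t4`, spine estimate NE7b (`T4WeightBudget.RelWeightBound`; the cell's OWN estimate — NOT PRINTED in
[Bałaban 1983–89], NOT PROVED).  Crux-route work under `Spine/NE7b/` by the row OWNER (`t4-ne7b-p1` gen 146, file (685)) under FREEZE
(0)'s crux-prover clause; NOTHING of Bałaban's is named as a Lean object, valued or asserted; no `T4Continuum/Support` leaf typed; no
`def`, no notation (group functions and majorants WRITTEN OUT); zero `sorry`.
Imports (BY NAME): `…SupFifthKernelEntryGroupFour`, `…SupInterpolatedFifthPieces`, `…SupInterpolatedFifthTreePieces`.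

WHAT IS PROVED ([folklore]): **`interpolated_fifth_entry_group_kappa3B`**, **`interpolated_fifth_entry_group_kappa3A`**; toy.

HONEST (what this is NOT).  Entrywise majorants; the weighted slot letters of `M₅′`, the Schur operator letter and the packaging are the next
files; `D`'s letters, weights, profiles, letter constants and the `r₁` compatibilities are hypotheses.  Scalar skeleton ((A3), NC-NE7b-α UNRULED);
nothing of Bałaban's asserted.  BY-NAME EFFECT ON THE WALL: NONE.  NE7b NOT PRINTED ∕ NOT PROVED; spine PROVED 0∕9; rung (B)+1 — the programme's
measures remain FINITE-torus statements; NOT the mass gap, NOT Clay.  HONEST DEPENDENCY: continuum YM on T⁴ ⇐ BetaPertH ∧ nine spine estimates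
(0∕9 proved); BetaPertH ⇐ (D1) ∧ (D4) ∧ CAP+tail; G-an2-4 gates asym, D1 and NE2∕3∕4.
-/

set_option autoImplicit false
set_option maxSynthPendingDepth 4

noncomputable section

namespace Summit.QuantumFields.BalabanUV.T4Continuum.NE7b.SupInterpolatedFifthGroupFour

open MeasureTheory ProbabilityTheory Finset Real Matrix
open scoped BigOperators Matrix
open SupEffectiveActionDerivative (mul_opBound_le_of_le)
open SupWhitenedMomentLetters (posSemidef_AAT)
open SupFifthKernelSums (abs_split_cov4 abs_split_cov3 abs_split_kappa3 abs_split_u4)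
open SupFifthKernelEntryGlue (cov_symm_pt cm3_cyc_pt cm3_swap12_pt cm3_swap13_pt u4_cyc_pt u4_4213_pt u4_swap12_pt u4_3124_pt u5_cyc_pt)
open SupFifthFormGroupFourTwo (hasDerivAt_display4_kappa3A_line)
open SupFifthFormGroupFour (hasDerivAt_display4_kappa3B_line)
open SupHessFourthCumulantEntriesTilted (hess_fourth_cumulant_entry_tilted_two)
open SupFifthKernelEntryPieces (hesshess_grad_entry_ite third_gradgrad_entry_ite)
open SupInterpolatedFifthPieces (interpolated_third_gradgrad_entry interpolated_hesshess_grad_entry)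
open SupInterpolatedFifthTreePieces (interpolated_hess_fourth_cumulant_entry_two)

variable {ι κ : Type} [Fintype ι] [DecidableEq ι] [Fintype κ] [DecidableEq κ]

variable {U : EuclideanSpace ℝ ι → ℝ} {U' : EuclideanSpace ℝ ι → EuclideanSpace ℝ ι →L[ℝ] ℝ}
  {U'' : EuclideanSpace ℝ ι → EuclideanSpace ℝ ι →L[ℝ] EuclideanSpace ℝ ι →L[ℝ] ℝ}
  {U₃ : EuclideanSpace ℝ ι → EuclideanSpace ℝ ι →L[ℝ] EuclideanSpace ℝ ι →L[ℝ] EuclideanSpace ℝ ι →L[ℝ] ℝ}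
  {U₄ : EuclideanSpace ℝ ι → EuclideanSpace ℝ ι →L[ℝ] EuclideanSpace ℝ ι →L[ℝ] EuclideanSpace ℝ ι →L[ℝ] EuclideanSpace ℝ ι →L[ℝ] ℝ}
  {U₅ : EuclideanSpace ℝ ι →
    EuclideanSpace ℝ ι →L[ℝ] EuclideanSpace ℝ ι →L[ℝ] EuclideanSpace ℝ ι →L[ℝ] EuclideanSpace ℝ ι →L[ℝ] EuclideanSpace ℝ ι →L[ℝ] ℝ}
  {Hk : ι → ι → ℝ} {K3 : ι → ι → ι → ℝ} {K4 : ι → ι → ι → ι → ℝ} {K5 : ι → ι → ι → ι → ι → ℝ} {A : Matrix ι κ ℝ} {D : κ → κ → ℝ}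
  {γop κ₀ κ₁ κ₂ κ₃ κ₄ κ₅ κ₅r a τ δ θp lam lamA αr αc hr hc k3r k3c k4r k4c k5r k5c γ dr dc dθ dθ' αθ βθ S S' S₁ n₃ : ℝ} {θ : κ → κ → ℝ}
  {σ : ι → κ → ℝ} {ρ r r₁ : ι → ι → ℝ} {C3k C3h C4 C5 : ℝ}

set_option synthInstance.maxHeartbeats 200000 in
set_option maxHeartbeats 400000 in
/-- **Group four, first half, entrywise**: twelve placements — supported centred triples ((603)) and the `u₄(U′x,U″,U′,U′)` tree entries
((604)). — INTERPOLATED form: every supported (`𝟙[· ≠ 0]`) term replaced by its interpolated ∕ full-graph bound ((678), (680), (683)), all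
other terms and the proof verbatim. [folklore] -/
theorem interpolated_fifth_entry_group_kappa3B [Nonempty κ]
    (hΓop : (γop • (1 : Matrix ι ι ℝ) - A * Aᵀ).PosSemidef) (Y : Finset ι) (hUd : ∀ φ : EuclideanSpace ℝ ι, HasFDerivAt U (U' φ) φ)
    (hU'd : ∀ φ : EuclideanSpace ℝ ι, HasFDerivAt U' (U'' φ) φ) (hU''d : ∀ φ : EuclideanSpace ℝ ι, HasFDerivAt U'' (U₃ φ) φ)
    (hU₃d : ∀ φ : EuclideanSpace ℝ ι, HasFDerivAt U₃ (U₄ φ) φ) (hU₄d : ∀ φ : EuclideanSpace ℝ ι, HasFDerivAt U₄ (U₅ φ) φ) (hκ₀ : 0 ≤ κ₀)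
    (hκ₁ : 0 ≤ κ₁) (ha : 0 ≤ a) (hτ : 0 < τ) (hδ : 0 < δ) (hθ0 : 0 < θp) (hθ1 : θp < 1) (hκθ : (2 * κ₀ * (1 + τ) + 4 * δ) * γop ≤ θp)
    (hκθw : 2 * κ₀ * (1 + τ) * γop + 4 * δ ≤ θp) (hstab : ∀ φ : EuclideanSpace ℝ ι, -(κ₀ * ∑ x ∈ Y, φ x ^ 2) ≤ U φ)
    (hU'b : ∀ φ : EuclideanSpace ℝ ι, ‖U' φ‖ ≤ κ₁ * (a + ∑ x ∈ Y, φ x ^ 2)) (hU''b : ∀ φ : EuclideanSpace ℝ ι, ‖U'' φ‖ ≤ κ₂)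
    (hU₃b : ∀ φ : EuclideanSpace ℝ ι, ‖U₃ φ‖ ≤ κ₃) (hU₄b : ∀ φ : EuclideanSpace ℝ ι, ‖U₄ φ‖ ≤ κ₄) (hlam : 0 ≤ lam)
    (hUsec : ∀ s : ℝ, 0 ≤ s → s ≤ 1 → ∀ a b : EuclideanSpace ℝ ι,
      U ((1 - s) • a + s • b) - lam / 2 * (s * (1 - s)) * ∑ i, (a i - b i) ^ 2 ≤ (1 - s) * U a + s * U b)
    (hρg : lam * γop < 1)
    (hHk : ∀ (φ : EuclideanSpace ℝ ι) (x z : ι), |U'' φ (EuclideanSpace.single z (1 : ℝ)) (EuclideanSpace.single x (1 : ℝ))| ≤ Hk x z)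
    (hHk0 : ∀ v u, 0 ≤ Hk v u)
    (hK3 : ∀ (φ : EuclideanSpace ℝ ι) (u x y : ι),
      |U₃ φ (EuclideanSpace.single u (1 : ℝ)) (EuclideanSpace.single x (1 : ℝ)) (EuclideanSpace.single y (1 : ℝ))| ≤ K3 x y u)
    (hK30 : ∀ x y u, 0 ≤ K3 x y u)
    (hK4 : ∀ (φ : EuclideanSpace ℝ ι) (u x y z : ι), |U₄ φ (EuclideanSpace.single u (1 : ℝ)) (EuclideanSpace.single x (1 : ℝ))
      (EuclideanSpace.single y (1 : ℝ)) (EuclideanSpace.single z (1 : ℝ))| ≤ K4 x y z u)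
    (hK40 : ∀ x y z u, 0 ≤ K4 x y z u) (hhr : ∀ v, ∑ u, Hk v u ≤ hr) (ψ : EuclideanSpace ℝ ι) (hαr : ∀ u, ∑ w, |A u w| ≤ αr)
    (hαc : ∀ w, ∑ u, |A u w| ≤ αc) (hlamA : ∀ x : κ, ∑ u, ∑ v, |A u x| * |A v x| * Hk v u ≤ lamA) (hlamA1 : lamA < 1)
    (hγ : αc * hr * αr / (1 - lamA) ≤ γ) (hγ1 : γ < 1) (hD : ∀ x y, 0 ≤ D x y)
    (hDC : ∀ x y, (if x = y then (1 : ℝ) else 0) + ∑ z, D x z * ((if y = z then 0 else ∑ u, ∑ v, |A u y| * |A v z| * Hk v u) / (1 - lamA)) ≤ D x y)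
    (hθnn : ∀ z w, 0 ≤ θ z w) (hDθr : ∀ z, ∑ w, D z w * θ z w ≤ dθ) (hdθ : 0 ≤ dθ) (hDθc : ∀ w, ∑ z, D z w * θ z w ≤ dθ') (hdθ' : 0 ≤ dθ')
    (hσ0 : ∀ x w, 0 ≤ σ x w) (hσθ : ∀ x z w, σ x w ≤ σ x z * θ z w) (hρ1 : ∀ x y, 1 ≤ ρ x y) (hρsymm : ∀ x y, ρ x y = ρ y x)
    (hρmul : ∀ x y z, ρ x z ≤ ρ x y * ρ y z) (hρσ : ∀ x y w, ρ x y ^ 8 ≤ σ x w * σ y w) (hr1 : ∀ x y, 1 ≤ r x y)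
    (hrσ : ∀ x y w, r x y ^ 24 ≤ σ x w * σ y w) (haσ : ∀ v : ι, ∑ w, (∑ u, |A u w| * Hk v u) * σ v w ≤ αθ) (hβ : 0 ≤ βθ)
    (haσ' : ∀ (v : ι) (w : κ), (∑ u, |A u w| * Hk v u) * σ v w ≤ βθ) (hgσ : ∀ p q : ι, ∑ w, (∑ u, |A u w| * K3 p q u) * σ p w ≤ αθ)
    (hgσ' : ∀ (p q : ι) (w : κ), (∑ u, |A u w| * K3 p q u) * σ p w ≤ βθ) (hkσ : ∀ p q o : ι, ∑ w, (∑ u, |A u w| * K4 p q o u) * σ p w ≤ αθ)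
    (hkσ' : ∀ (p q o : ι) (w : κ), (∑ u, |A u w| * K4 p q o u) * σ p w ≤ βθ)
    (hC3k : 4 * Real.sqrt ((5 * ((κ₂ ^ 4 + κ₄ ^ 4) * γop ^ 2) / (1 - lam * γop) ^ 2) * (αθ * dθ * (βθ * dθ') / (1 - lamA))) ≤ C3k)
    (hC3h : 4 * Real.sqrt ((5 * ((κ₂ ^ 4 + κ₃ ^ 4) * γop ^ 2) / (1 - lam * γop) ^ 2) * (αθ * dθ * (βθ * dθ') / (1 - lamA))) ≤ C3h)
    (hC4 : (4 * (αθ * dθ * (βθ * dθ') / (1 - lamA)) + 3 * (αθ * dθ * (βθ * dθ') / (1 - lamA)) ^ 2 + 4 * (5 * ((κ₂ ^ 4 + κ₃ ^ 4) * γop ^ 2) / (1 -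
          lam
        * γop) ^ 2) + 4 * (50 * ((κ₂ ^ 6 + κ₃ ^ 6) * γop ^ 3) / (1 - lam * γop) ^ 3) + 2 * (((5 * ((κ₂ ^ 4 + κ₃ ^ 4) * γop ^ 2) / (1 - lam * γop) ^
        2) + 1) / 2) * ((((5 * ((κ₂ ^ 4 + κ₃ ^ 4) * γop ^ 2) / (1 - lam * γop) ^ 2) + 1) / 2) + (5 * ((κ₂ ^ 4 + κ₃ ^ 4) * γop ^ 2) / (1 - lam * γop)
        ^ 2))) ≤ C4)
    (hr₁1 : ∀ x y, 1 ≤ r₁ x y) (hr₁symm : ∀ x y, r₁ x y = r₁ y x) (hr₁mul : ∀ x y z, r₁ x z ≤ r₁ x y * r₁ y z) (hr₁8 : ∀ x y, r₁ x y ^ 8 ≤ r x y)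
          (hC40 : 0 ≤ C4)
    (x : ι) (y z t s : ι) :
    |deriv (fun σ : ℝ => ((∫ ω : EuclideanSpace ℝ ι, exp (-U (ω + (ψ + σ • EuclideanSpace.single x (1 : ℝ)))) ∂(multivariateGaussian 0 (A * Aᵀ)))⁻¹
          * (∫ ω : EuclideanSpace ℝ ι, exp (-U (ω + (ψ + σ • EuclideanSpace.single x (1 : ℝ)))) * ((U'' (ω + (ψ + σ • EuclideanSpace.single x (1 :
          ℝ))) (EuclideanSpace.single y (1 : ℝ)) (EuclideanSpace.single z (1 : ℝ)) - ((∫ ω : EuclideanSpace ℝ ι, exp (-U (ω + (ψ + σ •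
          EuclideanSpace.single x (1 : ℝ)))) ∂(multivariateGaussian 0 (A * Aᵀ)))⁻¹ * (∫ ω : EuclideanSpace ℝ ι, exp (-U (ω + (ψ + σ •
          EuclideanSpace.single x (1 : ℝ)))) * U'' (ω + (ψ + σ • EuclideanSpace.single x (1 : ℝ))) (EuclideanSpace.single y (1 : ℝ))
          (EuclideanSpace.single z (1 : ℝ)) ∂(multivariateGaussian 0 (A * Aᵀ))))) * (U' (ω + (ψ + σ • EuclideanSpace.single x (1 : ℝ)))
          (EuclideanSpace.single t (1 : ℝ)) - ((∫ ω : EuclideanSpace ℝ ι, exp (-U (ω + (ψ + σ • EuclideanSpace.single x (1 : ℝ))))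
          ∂(multivariateGaussian 0 (A * Aᵀ)))⁻¹ * (∫ ω : EuclideanSpace ℝ ι, exp (-U (ω + (ψ + σ • EuclideanSpace.single x (1 : ℝ)))) * U' (ω + (ψ
          + σ • EuclideanSpace.single x (1 : ℝ))) (EuclideanSpace.single t (1 : ℝ)) ∂(multivariateGaussian 0 (A * Aᵀ))))) * (U' (ω + (ψ + σ •
          EuclideanSpace.single x (1 : ℝ))) (EuclideanSpace.single s (1 : ℝ)) - ((∫ ω : EuclideanSpace ℝ ι, exp (-U (ω + (ψ + σ •
          EuclideanSpace.single x (1 : ℝ)))) ∂(multivariateGaussian 0 (A * Aᵀ)))⁻¹ * (∫ ω : EuclideanSpace ℝ ι, exp (-U (ω + (ψ + σ •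
          EuclideanSpace.single x (1 : ℝ)))) * U' (ω + (ψ + σ • EuclideanSpace.single x (1 : ℝ))) (EuclideanSpace.single s (1 : ℝ))
          ∂(multivariateGaussian 0 (A * Aᵀ)))))) ∂(multivariateGaussian 0 (A * Aᵀ)))) + ((∫ ω : EuclideanSpace ℝ ι, exp (-U (ω + (ψ + σ •
          EuclideanSpace.single x (1 : ℝ)))) ∂(multivariateGaussian 0 (A * Aᵀ)))⁻¹ * (∫ ω : EuclideanSpace ℝ ι, exp (-U (ω + (ψ + σ •
          EuclideanSpace.single x (1 : ℝ)))) * ((U'' (ω + (ψ + σ • EuclideanSpace.single x (1 : ℝ))) (EuclideanSpace.single y (1 : ℝ))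
          (EuclideanSpace.single t (1 : ℝ)) - ((∫ ω : EuclideanSpace ℝ ι, exp (-U (ω + (ψ + σ • EuclideanSpace.single x (1 : ℝ))))
          ∂(multivariateGaussian 0 (A * Aᵀ)))⁻¹ * (∫ ω : EuclideanSpace ℝ ι, exp (-U (ω + (ψ + σ • EuclideanSpace.single x (1 : ℝ)))) * U'' (ω + (ψ
          + σ • EuclideanSpace.single x (1 : ℝ))) (EuclideanSpace.single y (1 : ℝ)) (EuclideanSpace.single t (1 : ℝ)) ∂(multivariateGaussian 0 (A *
          Aᵀ))))) * (U' (ω + (ψ + σ • EuclideanSpace.single x (1 : ℝ))) (EuclideanSpace.single z (1 : ℝ)) - ((∫ ω : EuclideanSpace ℝ ι, exp (-U (ω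
          + (ψ + σ • EuclideanSpace.single x (1 : ℝ)))) ∂(multivariateGaussian 0 (A * Aᵀ)))⁻¹ * (∫ ω : EuclideanSpace ℝ ι, exp (-U (ω + (ψ + σ •
          EuclideanSpace.single x (1 : ℝ)))) * U' (ω + (ψ + σ • EuclideanSpace.single x (1 : ℝ))) (EuclideanSpace.single z (1 : ℝ))
          ∂(multivariateGaussian 0 (A * Aᵀ))))) * (U' (ω + (ψ + σ • EuclideanSpace.single x (1 : ℝ))) (EuclideanSpace.single s (1 : ℝ)) - ((∫ ω :
          EuclideanSpace ℝ ι, exp (-U (ω + (ψ + σ • EuclideanSpace.single x (1 : ℝ)))) ∂(multivariateGaussian 0 (A * Aᵀ)))⁻¹ * (∫ ω :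
          EuclideanSpace ℝ ι, exp (-U (ω + (ψ + σ • EuclideanSpace.single x (1 : ℝ)))) * U' (ω + (ψ + σ • EuclideanSpace.single x (1 : ℝ)))
          (EuclideanSpace.single s (1 : ℝ)) ∂(multivariateGaussian 0 (A * Aᵀ)))))) ∂(multivariateGaussian 0 (A * Aᵀ)))) + ((∫ ω : EuclideanSpace ℝ
          ι, exp (-U (ω + (ψ + σ • EuclideanSpace.single x (1 : ℝ)))) ∂(multivariateGaussian 0 (A * Aᵀ)))⁻¹ * (∫ ω : EuclideanSpace ℝ ι, exp (-U (ω
          + (ψ + σ • EuclideanSpace.single x (1 : ℝ)))) * ((U'' (ω + (ψ + σ • EuclideanSpace.single x (1 : ℝ))) (EuclideanSpace.single y (1 : ℝ))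
          (EuclideanSpace.single s (1 : ℝ)) - ((∫ ω : EuclideanSpace ℝ ι, exp (-U (ω + (ψ + σ • EuclideanSpace.single x (1 : ℝ))))
          ∂(multivariateGaussian 0 (A * Aᵀ)))⁻¹ * (∫ ω : EuclideanSpace ℝ ι, exp (-U (ω + (ψ + σ • EuclideanSpace.single x (1 : ℝ)))) * U'' (ω + (ψ
          + σ • EuclideanSpace.single x (1 : ℝ))) (EuclideanSpace.single y (1 : ℝ)) (EuclideanSpace.single s (1 : ℝ)) ∂(multivariateGaussian 0 (A *
          Aᵀ))))) * (U' (ω + (ψ + σ • EuclideanSpace.single x (1 : ℝ))) (EuclideanSpace.single z (1 : ℝ)) - ((∫ ω : EuclideanSpace ℝ ι, exp (-U (ω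
          + (ψ + σ • EuclideanSpace.single x (1 : ℝ)))) ∂(multivariateGaussian 0 (A * Aᵀ)))⁻¹ * (∫ ω : EuclideanSpace ℝ ι, exp (-U (ω + (ψ + σ •
          EuclideanSpace.single x (1 : ℝ)))) * U' (ω + (ψ + σ • EuclideanSpace.single x (1 : ℝ))) (EuclideanSpace.single z (1 : ℝ))
          ∂(multivariateGaussian 0 (A * Aᵀ))))) * (U' (ω + (ψ + σ • EuclideanSpace.single x (1 : ℝ))) (EuclideanSpace.single t (1 : ℝ)) - ((∫ ω :
          EuclideanSpace ℝ ι, exp (-U (ω + (ψ + σ • EuclideanSpace.single x (1 : ℝ)))) ∂(multivariateGaussian 0 (A * Aᵀ)))⁻¹ * (∫ ω :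
          EuclideanSpace ℝ ι, exp (-U (ω + (ψ + σ • EuclideanSpace.single x (1 : ℝ)))) * U' (ω + (ψ + σ • EuclideanSpace.single x (1 : ℝ)))
          (EuclideanSpace.single t (1 : ℝ)) ∂(multivariateGaussian 0 (A * Aᵀ)))))) ∂(multivariateGaussian 0 (A * Aᵀ))))) 0| ≤
      (Real.sqrt (2 * K3 y z x * Real.sqrt (5 * (κ₂ ^ 4 * γop ^ 2) / (1 - lam * γop) ^ 2) * C3k) / Real.sqrt (ρ x t * ρ x s) : ℝ) + (Real.sqrt (4 *
            Hk t x * Hk z y * Real.sqrt (Real.sqrt (5 * (κ₂ ^ 4 * γop ^ 2) / (1 - lam * γop) ^ 2)) * C3h) / Real.sqrt (ρ x y * ρ x s) : ℝ) +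
            (Real.sqrt (4 * Hk s x * Hk z y * Real.sqrt (Real.sqrt (5 * (κ₂ ^ 4 * γop ^ 2) / (1 - lam * γop) ^ 2)) * C3h) / Real.sqrt (ρ x y * ρ x
            t) : ℝ) + (Real.sqrt (16 * (8 * Hk z y * (Real.sqrt (5 * (κ₂ ^ 4 * γop ^ 2) / (1 - lam * γop) ^ 2) * Real.sqrt (Real.sqrt (5 * (κ₂ ^ 4
            * γop ^ 2) / (1 - lam * γop) ^ 2))) * C4)) * ((r₁ x y)⁻¹ * (r₁ x t)⁻¹ * (r₁ x s)⁻¹ * (r₁ y t)⁻¹ * (r₁ y s)⁻¹ * (r₁ t s)⁻¹) : ℝ) +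
            (Real.sqrt (2 * K3 y t x * Real.sqrt (5 * (κ₂ ^ 4 * γop ^ 2) / (1 - lam * γop) ^ 2) * C3k) / Real.sqrt (ρ x z * ρ x s) : ℝ) +
            (Real.sqrt (4 * Hk z x * Hk t y * Real.sqrt (Real.sqrt (5 * (κ₂ ^ 4 * γop ^ 2) / (1 - lam * γop) ^ 2)) * C3h) / Real.sqrt (ρ x y * ρ x
            s) : ℝ) + (Real.sqrt (4 * Hk s x * Hk t y * Real.sqrt (Real.sqrt (5 * (κ₂ ^ 4 * γop ^ 2) / (1 - lam * γop) ^ 2)) * C3h) / Real.sqrt (ρ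
            x y * ρ x z) : ℝ) + (Real.sqrt (16 * (8 * Hk t y * (Real.sqrt (5 * (κ₂ ^ 4 * γop ^ 2) / (1 - lam * γop) ^ 2) * Real.sqrt (Real.sqrt (5
            * (κ₂ ^ 4 * γop ^ 2) / (1 - lam * γop) ^ 2))) * C4)) * ((r₁ x y)⁻¹ * (r₁ x z)⁻¹ * (r₁ x s)⁻¹ * (r₁ y z)⁻¹ * (r₁ y s)⁻¹ * (r₁ z s)⁻¹) :
            ℝ) + (Real.sqrt (2 * K3 y s x * Real.sqrt (5 * (κ₂ ^ 4 * γop ^ 2) / (1 - lam * γop) ^ 2) * C3k) / Real.sqrt (ρ x z * ρ x t) : ℝ) +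
            (Real.sqrt (4 * Hk z x * Hk s y * Real.sqrt (Real.sqrt (5 * (κ₂ ^ 4 * γop ^ 2) / (1 - lam * γop) ^ 2)) * C3h) / Real.sqrt (ρ x y * ρ x
            t) : ℝ) + (Real.sqrt (4 * Hk t x * Hk s y * Real.sqrt (Real.sqrt (5 * (κ₂ ^ 4 * γop ^ 2) / (1 - lam * γop) ^ 2)) * C3h) / Real.sqrt (ρ
            x y * ρ x z) : ℝ) + (Real.sqrt (16 * (8 * Hk s y * (Real.sqrt (5 * (κ₂ ^ 4 * γop ^ 2) / (1 - lam * γop) ^ 2) * Real.sqrt (Real.sqrt (5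
            * (κ₂ ^ 4 * γop ^ 2) / (1 - lam * γop) ^ 2))) * C4)) * ((r₁ x y)⁻¹ * (r₁ x z)⁻¹ * (r₁ x t)⁻¹ * (r₁ y z)⁻¹ * (r₁ y t)⁻¹ * (r₁ z t)⁻¹) :
            ℝ) := by
  have hΓ : (A * Aᵀ).PosSemidef := posSemidef_AAT A
  have hU₃c : Continuous U₃ := continuous_iff_continuousAt.2 fun φ => (hU₃d φ).continuousAt
  have hU₄c : Continuous U₄ := continuous_iff_continuousAt.2 fun φ => (hU₄d φ).continuousAt
  rw [(hasDerivAt_display4_kappa3B_line hΓ hΓop Y hUd hU'd hU''d hU₃c hκ₀ hκ₁ ha hτ hδ hθ0 hθ1 hκθ hstab hU'b hU''b hU₃b ψ (EuclideanSpace.single x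
        (1 : ℝ)) (EuclideanSpace.single y (1 : ℝ)) (EuclideanSpace.single z (1 : ℝ)) (EuclideanSpace.single t (1 : ℝ)) (EuclideanSpace.single s (1
        : ℝ))).deriv]
  have h1 := interpolated_third_gradgrad_entry hΓop Y hUd hU'd hU''d hU₃d hU₄c hκ₀ hκ₁ ha hτ hδ hθ0 hθ1 hκθ hκθw hstab hU'b hU''b hU₃b hU₄b hlam
        hUsec hρg hHk hHk0 hK4 ψ hK40 hαr hαc hhr hlamA hlamA1 hγ hγ1 hD hDC hθnn hDθr hdθ hDθc hdθ' hσ0 hσθ hρ1 hρsymm hρmul hρσ haσ hβ haσ' hkσ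
        hkσ' hK3 hC3k x y z t s
  have h2 := ((congrArg abs (cm3_swap12_pt _ _ _ _ _ _ _ _ _)).trans_le (interpolated_hesshess_grad_entry hΓop Y hUd hU'd hU''d hU₃c hκ₀ hκ₁ ha hτ
        hδ hθ0 hθ1 hκθ hκθw hstab hU'b hU''b hU₃b hlam hUsec hρg hHk hHk0 hK3 ψ hK30 hαr hαc hhr hlamA hlamA1 hγ hγ1 hD hDC hθnn hDθr hdθ hDθc hdθ'
        hσ0 hσθ hρ1 hρsymm hρmul hρσ haσ hβ haσ' hgσ hgσ' hC3h x t y z s))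
  have h3 := ((congrArg abs (cm3_cyc_pt _ _ _ _ _ _ _ _ _)).trans_le (interpolated_hesshess_grad_entry hΓop Y hUd hU'd hU''d hU₃c hκ₀ hκ₁ ha hτ hδ
        hθ0 hθ1 hκθ hκθw hstab hU'b hU''b hU₃b hlam hUsec hρg hHk hHk0 hK3 ψ hK30 hαr hαc hhr hlamA hlamA1 hγ hγ1 hD hDC hθnn hDθr hdθ hDθc hdθ'
        hσ0 hσθ hρ1 hρsymm hρmul hρσ haσ hβ haσ' hgσ hgσ' hC3h x s y z t))
  have h4 := ((congrArg abs (u4_cyc_pt _ _ _ _ _ _ _ _ _ _ _)).trans_le (interpolated_hess_fourth_cumulant_entry_two hΓop Y hUd hU'd hU''d hU₃c hκ₀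
        hκ₁ ha hτ hδ hθ0 hθ1 hκθ hκθw hstab hU'b hU''b hU₃b hlam hUsec hρg hHk hHk0 hK3 hK30 ψ hαr hαc hhr hlamA hlamA1 hγ hγ1 hD hDC hθnn hDθr hdθ
        hDθc hdθ' hσ0 hσθ hr1 hrσ haσ hβ haσ' hgσ hgσ' hC4 hr₁1 hr₁symm hr₁mul hr₁8 hC40 x y z t s))
  have h5 := interpolated_third_gradgrad_entry hΓop Y hUd hU'd hU''d hU₃d hU₄c hκ₀ hκ₁ ha hτ hδ hθ0 hθ1 hκθ hκθw hstab hU'b hU''b hU₃b hU₄b hlam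
        hUsec hρg hHk hHk0 hK4 ψ hK40 hαr hαc hhr hlamA hlamA1 hγ hγ1 hD hDC hθnn hDθr hdθ hDθc hdθ' hσ0 hσθ hρ1 hρsymm hρmul hρσ haσ hβ haσ' hkσ
        hkσ' hK3 hC3k x y t z s
  have h6 := ((congrArg abs (cm3_swap12_pt _ _ _ _ _ _ _ _ _)).trans_le (interpolated_hesshess_grad_entry hΓop Y hUd hU'd hU''d hU₃c hκ₀ hκ₁ ha hτ
        hδ hθ0 hθ1 hκθ hκθw hstab hU'b hU''b hU₃b hlam hUsec hρg hHk hHk0 hK3 ψ hK30 hαr hαc hhr hlamA hlamA1 hγ hγ1 hD hDC hθnn hDθr hdθ hDθc hdθ'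
        hσ0 hσθ hρ1 hρsymm hρmul hρσ haσ hβ haσ' hgσ hgσ' hC3h x z y t s))
  have h7 := ((congrArg abs (cm3_cyc_pt _ _ _ _ _ _ _ _ _)).trans_le (interpolated_hesshess_grad_entry hΓop Y hUd hU'd hU''d hU₃c hκ₀ hκ₁ ha hτ hδ
        hθ0 hθ1 hκθ hκθw hstab hU'b hU''b hU₃b hlam hUsec hρg hHk hHk0 hK3 ψ hK30 hαr hαc hhr hlamA hlamA1 hγ hγ1 hD hDC hθnn hDθr hdθ hDθc hdθ'
        hσ0 hσθ hρ1 hρsymm hρmul hρσ haσ hβ haσ' hgσ hgσ' hC3h x s y t z))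
  have h8 := ((congrArg abs (u4_cyc_pt _ _ _ _ _ _ _ _ _ _ _)).trans_le (interpolated_hess_fourth_cumulant_entry_two hΓop Y hUd hU'd hU''d hU₃c hκ₀
        hκ₁ ha hτ hδ hθ0 hθ1 hκθ hκθw hstab hU'b hU''b hU₃b hlam hUsec hρg hHk hHk0 hK3 hK30 ψ hαr hαc hhr hlamA hlamA1 hγ hγ1 hD hDC hθnn hDθr hdθ
        hDθc hdθ' hσ0 hσθ hr1 hrσ haσ hβ haσ' hgσ hgσ' hC4 hr₁1 hr₁symm hr₁mul hr₁8 hC40 x y t z s))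
  have h9 := interpolated_third_gradgrad_entry hΓop Y hUd hU'd hU''d hU₃d hU₄c hκ₀ hκ₁ ha hτ hδ hθ0 hθ1 hκθ hκθw hstab hU'b hU''b hU₃b hU₄b hlam
        hUsec hρg hHk hHk0 hK4 ψ hK40 hαr hαc hhr hlamA hlamA1 hγ hγ1 hD hDC hθnn hDθr hdθ hDθc hdθ' hσ0 hσθ hρ1 hρsymm hρmul hρσ haσ hβ haσ' hkσ
        hkσ' hK3 hC3k x y s z t
  have h10 := ((congrArg abs (cm3_swap12_pt _ _ _ _ _ _ _ _ _)).trans_le (interpolated_hesshess_grad_entry hΓop Y hUd hU'd hU''d hU₃c hκ₀ hκ₁ ha hτ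
        hδ hθ0 hθ1 hκθ hκθw hstab hU'b hU''b hU₃b hlam hUsec hρg hHk hHk0 hK3 ψ hK30 hαr hαc hhr hlamA hlamA1 hγ hγ1 hD hDC hθnn hDθr hdθ hDθc hdθ'
        hσ0 hσθ hρ1 hρsymm hρmul hρσ haσ hβ haσ' hgσ hgσ' hC3h x z y s t))
  have h11 := ((congrArg abs (cm3_cyc_pt _ _ _ _ _ _ _ _ _)).trans_le (interpolated_hesshess_grad_entry hΓop Y hUd hU'd hU''d hU₃c hκ₀ hκ₁ ha hτ hδ
        hθ0 hθ1 hκθ hκθw hstab hU'b hU''b hU₃b hlam hUsec hρg hHk hHk0 hK3 ψ hK30 hαr hαc hhr hlamA hlamA1 hγ hγ1 hD hDC hθnn hDθr hdθ hDθc hdθ'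
        hσ0 hσθ hρ1 hρsymm hρmul hρσ haσ hβ haσ' hgσ hgσ' hC3h x t y s z))
  have h12 := ((congrArg abs (u4_cyc_pt _ _ _ _ _ _ _ _ _ _ _)).trans_le (interpolated_hess_fourth_cumulant_entry_two hΓop Y hUd hU'd hU''d hU₃c
        hκ₀ hκ₁ ha hτ hδ hθ0 hθ1 hκθ hκθw hstab hU'b hU''b hU₃b hlam hUsec hρg hHk hHk0 hK3 hK30 ψ hαr hαc hhr hlamA hlamA1 hγ hγ1 hD hDC hθnn hDθr
        hdθ hDθc hdθ' hσ0 hσθ hr1 hrσ haσ hβ haσ' hgσ hgσ' hC4 hr₁1 hr₁symm hr₁mul hr₁8 hC40 x y s z t))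
  beta_reduce at h2 h3 h4 h6 h7 h8 h10 h11 h12
  exact (abs_split_kappa3 _ _ _ _ _ _ _ _ _ _ _ _ ).trans (add_le_add (add_le_add (add_le_add (add_le_add (add_le_add (add_le_add (add_le_add
        (add_le_add (add_le_add (add_le_add (add_le_add h1 h2) h3) h4) h5) h6) h7) h8) h9) h10) h11) h12)


set_option synthInstance.maxHeartbeats 200000 in
set_option maxHeartbeats 400000 in
/-- **Group four, second half, entrywise**: twelve placements, same pieces. — INTERPOLATED form: every supported (`𝟙[· ≠ 0]`) term replaced by
its interpolated ∕ full-graph bound ((678), (680), (683)), all other terms and the proof verbatim. [folklore] -/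
theorem interpolated_fifth_entry_group_kappa3A [Nonempty κ]
    (hΓop : (γop • (1 : Matrix ι ι ℝ) - A * Aᵀ).PosSemidef) (Y : Finset ι) (hUd : ∀ φ : EuclideanSpace ℝ ι, HasFDerivAt U (U' φ) φ)
    (hU'd : ∀ φ : EuclideanSpace ℝ ι, HasFDerivAt U' (U'' φ) φ) (hU''d : ∀ φ : EuclideanSpace ℝ ι, HasFDerivAt U'' (U₃ φ) φ)
    (hU₃d : ∀ φ : EuclideanSpace ℝ ι, HasFDerivAt U₃ (U₄ φ) φ) (hU₄d : ∀ φ : EuclideanSpace ℝ ι, HasFDerivAt U₄ (U₅ φ) φ) (hκ₀ : 0 ≤ κ₀)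
    (hκ₁ : 0 ≤ κ₁) (ha : 0 ≤ a) (hτ : 0 < τ) (hδ : 0 < δ) (hθ0 : 0 < θp) (hθ1 : θp < 1) (hκθ : (2 * κ₀ * (1 + τ) + 4 * δ) * γop ≤ θp)
    (hκθw : 2 * κ₀ * (1 + τ) * γop + 4 * δ ≤ θp) (hstab : ∀ φ : EuclideanSpace ℝ ι, -(κ₀ * ∑ x ∈ Y, φ x ^ 2) ≤ U φ)
    (hU'b : ∀ φ : EuclideanSpace ℝ ι, ‖U' φ‖ ≤ κ₁ * (a + ∑ x ∈ Y, φ x ^ 2)) (hU''b : ∀ φ : EuclideanSpace ℝ ι, ‖U'' φ‖ ≤ κ₂)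
    (hU₃b : ∀ φ : EuclideanSpace ℝ ι, ‖U₃ φ‖ ≤ κ₃) (hU₄b : ∀ φ : EuclideanSpace ℝ ι, ‖U₄ φ‖ ≤ κ₄) (hlam : 0 ≤ lam)
    (hUsec : ∀ s : ℝ, 0 ≤ s → s ≤ 1 → ∀ a b : EuclideanSpace ℝ ι,
      U ((1 - s) • a + s • b) - lam / 2 * (s * (1 - s)) * ∑ i, (a i - b i) ^ 2 ≤ (1 - s) * U a + s * U b)
    (hρg : lam * γop < 1)
    (hHk : ∀ (φ : EuclideanSpace ℝ ι) (x z : ι), |U'' φ (EuclideanSpace.single z (1 : ℝ)) (EuclideanSpace.single x (1 : ℝ))| ≤ Hk x z)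
    (hHk0 : ∀ v u, 0 ≤ Hk v u)
    (hK3 : ∀ (φ : EuclideanSpace ℝ ι) (u x y : ι),
      |U₃ φ (EuclideanSpace.single u (1 : ℝ)) (EuclideanSpace.single x (1 : ℝ)) (EuclideanSpace.single y (1 : ℝ))| ≤ K3 x y u)
    (hK30 : ∀ x y u, 0 ≤ K3 x y u)
    (hK4 : ∀ (φ : EuclideanSpace ℝ ι) (u x y z : ι), |U₄ φ (EuclideanSpace.single u (1 : ℝ)) (EuclideanSpace.single x (1 : ℝ))
      (EuclideanSpace.single y (1 : ℝ)) (EuclideanSpace.single z (1 : ℝ))| ≤ K4 x y z u)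
    (hK40 : ∀ x y z u, 0 ≤ K4 x y z u) (hhr : ∀ v, ∑ u, Hk v u ≤ hr) (ψ : EuclideanSpace ℝ ι) (hαr : ∀ u, ∑ w, |A u w| ≤ αr)
    (hαc : ∀ w, ∑ u, |A u w| ≤ αc) (hlamA : ∀ x : κ, ∑ u, ∑ v, |A u x| * |A v x| * Hk v u ≤ lamA) (hlamA1 : lamA < 1)
    (hγ : αc * hr * αr / (1 - lamA) ≤ γ) (hγ1 : γ < 1) (hD : ∀ x y, 0 ≤ D x y)
    (hDC : ∀ x y, (if x = y then (1 : ℝ) else 0) + ∑ z, D x z * ((if y = z then 0 else ∑ u, ∑ v, |A u y| * |A v z| * Hk v u) / (1 - lamA)) ≤ D x y)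
    (hθnn : ∀ z w, 0 ≤ θ z w) (hDθr : ∀ z, ∑ w, D z w * θ z w ≤ dθ) (hdθ : 0 ≤ dθ) (hDθc : ∀ w, ∑ z, D z w * θ z w ≤ dθ') (hdθ' : 0 ≤ dθ')
    (hσ0 : ∀ x w, 0 ≤ σ x w) (hσθ : ∀ x z w, σ x w ≤ σ x z * θ z w) (hρ1 : ∀ x y, 1 ≤ ρ x y) (hρsymm : ∀ x y, ρ x y = ρ y x)
    (hρmul : ∀ x y z, ρ x z ≤ ρ x y * ρ y z) (hρσ : ∀ x y w, ρ x y ^ 8 ≤ σ x w * σ y w) (hr1 : ∀ x y, 1 ≤ r x y)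
    (hrσ : ∀ x y w, r x y ^ 24 ≤ σ x w * σ y w) (haσ : ∀ v : ι, ∑ w, (∑ u, |A u w| * Hk v u) * σ v w ≤ αθ) (hβ : 0 ≤ βθ)
    (haσ' : ∀ (v : ι) (w : κ), (∑ u, |A u w| * Hk v u) * σ v w ≤ βθ) (hgσ : ∀ p q : ι, ∑ w, (∑ u, |A u w| * K3 p q u) * σ p w ≤ αθ)
    (hgσ' : ∀ (p q : ι) (w : κ), (∑ u, |A u w| * K3 p q u) * σ p w ≤ βθ) (hkσ : ∀ p q o : ι, ∑ w, (∑ u, |A u w| * K4 p q o u) * σ p w ≤ αθ)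
    (hkσ' : ∀ (p q o : ι) (w : κ), (∑ u, |A u w| * K4 p q o u) * σ p w ≤ βθ)
    (hC3k : 4 * Real.sqrt ((5 * ((κ₂ ^ 4 + κ₄ ^ 4) * γop ^ 2) / (1 - lam * γop) ^ 2) * (αθ * dθ * (βθ * dθ') / (1 - lamA))) ≤ C3k)
    (hC3h : 4 * Real.sqrt ((5 * ((κ₂ ^ 4 + κ₃ ^ 4) * γop ^ 2) / (1 - lam * γop) ^ 2) * (αθ * dθ * (βθ * dθ') / (1 - lamA))) ≤ C3h)
    (hC4 : (4 * (αθ * dθ * (βθ * dθ') / (1 - lamA)) + 3 * (αθ * dθ * (βθ * dθ') / (1 - lamA)) ^ 2 + 4 * (5 * ((κ₂ ^ 4 + κ₃ ^ 4) * γop ^ 2) / (1 -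
          lam
        * γop) ^ 2) + 4 * (50 * ((κ₂ ^ 6 + κ₃ ^ 6) * γop ^ 3) / (1 - lam * γop) ^ 3) + 2 * (((5 * ((κ₂ ^ 4 + κ₃ ^ 4) * γop ^ 2) / (1 - lam * γop) ^
        2) + 1) / 2) * ((((5 * ((κ₂ ^ 4 + κ₃ ^ 4) * γop ^ 2) / (1 - lam * γop) ^ 2) + 1) / 2) + (5 * ((κ₂ ^ 4 + κ₃ ^ 4) * γop ^ 2) / (1 - lam * γop)
        ^ 2))) ≤ C4)
    (hr₁1 : ∀ x y, 1 ≤ r₁ x y) (hr₁symm : ∀ x y, r₁ x y = r₁ y x) (hr₁mul : ∀ x y z, r₁ x z ≤ r₁ x y * r₁ y z) (hr₁8 : ∀ x y, r₁ x y ^ 8 ≤ r x y)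
          (hC40 : 0 ≤ C4)
    (x : ι) (y z t s : ι) :
    |deriv (fun σ : ℝ => ((∫ ω : EuclideanSpace ℝ ι, exp (-U (ω + (ψ + σ • EuclideanSpace.single x (1 : ℝ)))) ∂(multivariateGaussian 0 (A * Aᵀ)))⁻¹
          * (∫ ω : EuclideanSpace ℝ ι, exp (-U (ω + (ψ + σ • EuclideanSpace.single x (1 : ℝ)))) * ((U' (ω + (ψ + σ • EuclideanSpace.single x (1 :
          ℝ))) (EuclideanSpace.single y (1 : ℝ)) - ((∫ ω : EuclideanSpace ℝ ι, exp (-U (ω + (ψ + σ • EuclideanSpace.single x (1 : ℝ))))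
          ∂(multivariateGaussian 0 (A * Aᵀ)))⁻¹ * (∫ ω : EuclideanSpace ℝ ι, exp (-U (ω + (ψ + σ • EuclideanSpace.single x (1 : ℝ)))) * U' (ω + (ψ
          + σ • EuclideanSpace.single x (1 : ℝ))) (EuclideanSpace.single y (1 : ℝ)) ∂(multivariateGaussian 0 (A * Aᵀ))))) * (U'' (ω + (ψ + σ •
          EuclideanSpace.single x (1 : ℝ))) (EuclideanSpace.single z (1 : ℝ)) (EuclideanSpace.single t (1 : ℝ)) - ((∫ ω : EuclideanSpace ℝ ι, exp
          (-U (ω + (ψ + σ • EuclideanSpace.single x (1 : ℝ)))) ∂(multivariateGaussian 0 (A * Aᵀ)))⁻¹ * (∫ ω : EuclideanSpace ℝ ι, exp (-U (ω + (ψ +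
          σ • EuclideanSpace.single x (1 : ℝ)))) * U'' (ω + (ψ + σ • EuclideanSpace.single x (1 : ℝ))) (EuclideanSpace.single z (1 : ℝ))
          (EuclideanSpace.single t (1 : ℝ)) ∂(multivariateGaussian 0 (A * Aᵀ))))) * (U' (ω + (ψ + σ • EuclideanSpace.single x (1 : ℝ)))
          (EuclideanSpace.single s (1 : ℝ)) - ((∫ ω : EuclideanSpace ℝ ι, exp (-U (ω + (ψ + σ • EuclideanSpace.single x (1 : ℝ))))
          ∂(multivariateGaussian 0 (A * Aᵀ)))⁻¹ * (∫ ω : EuclideanSpace ℝ ι, exp (-U (ω + (ψ + σ • EuclideanSpace.single x (1 : ℝ)))) * U' (ω + (ψ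
          + σ • EuclideanSpace.single x (1 : ℝ))) (EuclideanSpace.single s (1 : ℝ)) ∂(multivariateGaussian 0 (A * Aᵀ)))))) ∂(multivariateGaussian 0
          (A * Aᵀ)))) + ((∫ ω : EuclideanSpace ℝ ι, exp (-U (ω + (ψ + σ • EuclideanSpace.single x (1 : ℝ)))) ∂(multivariateGaussian 0 (A * Aᵀ)))⁻¹
          * (∫ ω : EuclideanSpace ℝ ι, exp (-U (ω + (ψ + σ • EuclideanSpace.single x (1 : ℝ)))) * ((U' (ω + (ψ + σ • EuclideanSpace.single x (1 :
          ℝ))) (EuclideanSpace.single y (1 : ℝ)) - ((∫ ω : EuclideanSpace ℝ ι, exp (-U (ω + (ψ + σ • EuclideanSpace.single x (1 : ℝ))))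
          ∂(multivariateGaussian 0 (A * Aᵀ)))⁻¹ * (∫ ω : EuclideanSpace ℝ ι, exp (-U (ω + (ψ + σ • EuclideanSpace.single x (1 : ℝ)))) * U' (ω + (ψ
          + σ • EuclideanSpace.single x (1 : ℝ))) (EuclideanSpace.single y (1 : ℝ)) ∂(multivariateGaussian 0 (A * Aᵀ))))) * (U'' (ω + (ψ + σ •
          EuclideanSpace.single x (1 : ℝ))) (EuclideanSpace.single z (1 : ℝ)) (EuclideanSpace.single s (1 : ℝ)) - ((∫ ω : EuclideanSpace ℝ ι, exp
          (-U (ω + (ψ + σ • EuclideanSpace.single x (1 : ℝ)))) ∂(multivariateGaussian 0 (A * Aᵀ)))⁻¹ * (∫ ω : EuclideanSpace ℝ ι, exp (-U (ω + (ψ +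
          σ • EuclideanSpace.single x (1 : ℝ)))) * U'' (ω + (ψ + σ • EuclideanSpace.single x (1 : ℝ))) (EuclideanSpace.single z (1 : ℝ))
          (EuclideanSpace.single s (1 : ℝ)) ∂(multivariateGaussian 0 (A * Aᵀ))))) * (U' (ω + (ψ + σ • EuclideanSpace.single x (1 : ℝ)))
          (EuclideanSpace.single t (1 : ℝ)) - ((∫ ω : EuclideanSpace ℝ ι, exp (-U (ω + (ψ + σ • EuclideanSpace.single x (1 : ℝ))))
          ∂(multivariateGaussian 0 (A * Aᵀ)))⁻¹ * (∫ ω : EuclideanSpace ℝ ι, exp (-U (ω + (ψ + σ • EuclideanSpace.single x (1 : ℝ)))) * U' (ω + (ψ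
          + σ • EuclideanSpace.single x (1 : ℝ))) (EuclideanSpace.single t (1 : ℝ)) ∂(multivariateGaussian 0 (A * Aᵀ)))))) ∂(multivariateGaussian 0
          (A * Aᵀ)))) + ((∫ ω : EuclideanSpace ℝ ι, exp (-U (ω + (ψ + σ • EuclideanSpace.single x (1 : ℝ)))) ∂(multivariateGaussian 0 (A * Aᵀ)))⁻¹
          * (∫ ω : EuclideanSpace ℝ ι, exp (-U (ω + (ψ + σ • EuclideanSpace.single x (1 : ℝ)))) * ((U' (ω + (ψ + σ • EuclideanSpace.single x (1 :
          ℝ))) (EuclideanSpace.single y (1 : ℝ)) - ((∫ ω : EuclideanSpace ℝ ι, exp (-U (ω + (ψ + σ • EuclideanSpace.single x (1 : ℝ))))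
          ∂(multivariateGaussian 0 (A * Aᵀ)))⁻¹ * (∫ ω : EuclideanSpace ℝ ι, exp (-U (ω + (ψ + σ • EuclideanSpace.single x (1 : ℝ)))) * U' (ω + (ψ
          + σ • EuclideanSpace.single x (1 : ℝ))) (EuclideanSpace.single y (1 : ℝ)) ∂(multivariateGaussian 0 (A * Aᵀ))))) * (U'' (ω + (ψ + σ •
          EuclideanSpace.single x (1 : ℝ))) (EuclideanSpace.single t (1 : ℝ)) (EuclideanSpace.single s (1 : ℝ)) - ((∫ ω : EuclideanSpace ℝ ι, exp
          (-U (ω + (ψ + σ • EuclideanSpace.single x (1 : ℝ)))) ∂(multivariateGaussian 0 (A * Aᵀ)))⁻¹ * (∫ ω : EuclideanSpace ℝ ι, exp (-U (ω + (ψ +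
          σ • EuclideanSpace.single x (1 : ℝ)))) * U'' (ω + (ψ + σ • EuclideanSpace.single x (1 : ℝ))) (EuclideanSpace.single t (1 : ℝ))
          (EuclideanSpace.single s (1 : ℝ)) ∂(multivariateGaussian 0 (A * Aᵀ))))) * (U' (ω + (ψ + σ • EuclideanSpace.single x (1 : ℝ)))
          (EuclideanSpace.single z (1 : ℝ)) - ((∫ ω : EuclideanSpace ℝ ι, exp (-U (ω + (ψ + σ • EuclideanSpace.single x (1 : ℝ))))
          ∂(multivariateGaussian 0 (A * Aᵀ)))⁻¹ * (∫ ω : EuclideanSpace ℝ ι, exp (-U (ω + (ψ + σ • EuclideanSpace.single x (1 : ℝ)))) * U' (ω + (ψ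
          + σ • EuclideanSpace.single x (1 : ℝ))) (EuclideanSpace.single z (1 : ℝ)) ∂(multivariateGaussian 0 (A * Aᵀ)))))) ∂(multivariateGaussian 0
          (A * Aᵀ))))) 0| ≤
      (Real.sqrt (4 * Hk y x * Hk t z * Real.sqrt (Real.sqrt (5 * (κ₂ ^ 4 * γop ^ 2) / (1 - lam * γop) ^ 2)) * C3h) / Real.sqrt (ρ x z * ρ x s) :
            ℝ) + (Real.sqrt (2 * K3 z t x * Real.sqrt (5 * (κ₂ ^ 4 * γop ^ 2) / (1 - lam * γop) ^ 2) * C3k) / Real.sqrt (ρ x y * ρ x s) : ℝ) +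
            (Real.sqrt (4 * Hk s x * Hk t z * Real.sqrt (Real.sqrt (5 * (κ₂ ^ 4 * γop ^ 2) / (1 - lam * γop) ^ 2)) * C3h) / Real.sqrt (ρ x z * ρ x
            y) : ℝ) + (Real.sqrt (16 * (8 * Hk t z * (Real.sqrt (5 * (κ₂ ^ 4 * γop ^ 2) / (1 - lam * γop) ^ 2) * Real.sqrt (Real.sqrt (5 * (κ₂ ^ 4
            * γop ^ 2) / (1 - lam * γop) ^ 2))) * C4)) * ((r₁ x z)⁻¹ * (r₁ x y)⁻¹ * (r₁ x s)⁻¹ * (r₁ z y)⁻¹ * (r₁ z s)⁻¹ * (r₁ y s)⁻¹) : ℝ) +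
            (Real.sqrt (4 * Hk y x * Hk s z * Real.sqrt (Real.sqrt (5 * (κ₂ ^ 4 * γop ^ 2) / (1 - lam * γop) ^ 2)) * C3h) / Real.sqrt (ρ x z * ρ x
            t) : ℝ) + (Real.sqrt (2 * K3 z s x * Real.sqrt (5 * (κ₂ ^ 4 * γop ^ 2) / (1 - lam * γop) ^ 2) * C3k) / Real.sqrt (ρ x y * ρ x t) : ℝ) +
            (Real.sqrt (4 * Hk t x * Hk s z * Real.sqrt (Real.sqrt (5 * (κ₂ ^ 4 * γop ^ 2) / (1 - lam * γop) ^ 2)) * C3h) / Real.sqrt (ρ x z * ρ x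
            y) : ℝ) + (Real.sqrt (16 * (8 * Hk s z * (Real.sqrt (5 * (κ₂ ^ 4 * γop ^ 2) / (1 - lam * γop) ^ 2) * Real.sqrt (Real.sqrt (5 * (κ₂ ^ 4
            * γop ^ 2) / (1 - lam * γop) ^ 2))) * C4)) * ((r₁ x z)⁻¹ * (r₁ x y)⁻¹ * (r₁ x t)⁻¹ * (r₁ z y)⁻¹ * (r₁ z t)⁻¹ * (r₁ y t)⁻¹) : ℝ) +
            (Real.sqrt (4 * Hk y x * Hk s t * Real.sqrt (Real.sqrt (5 * (κ₂ ^ 4 * γop ^ 2) / (1 - lam * γop) ^ 2)) * C3h) / Real.sqrt (ρ x t * ρ x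
            z) : ℝ) + (Real.sqrt (2 * K3 t s x * Real.sqrt (5 * (κ₂ ^ 4 * γop ^ 2) / (1 - lam * γop) ^ 2) * C3k) / Real.sqrt (ρ x y * ρ x z) : ℝ) +
            (Real.sqrt (4 * Hk z x * Hk s t * Real.sqrt (Real.sqrt (5 * (κ₂ ^ 4 * γop ^ 2) / (1 - lam * γop) ^ 2)) * C3h) / Real.sqrt (ρ x t * ρ x
            y) : ℝ) + (Real.sqrt (16 * (8 * Hk s t * (Real.sqrt (5 * (κ₂ ^ 4 * γop ^ 2) / (1 - lam * γop) ^ 2) * Real.sqrt (Real.sqrt (5 * (κ₂ ^ 4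
            * γop ^ 2) / (1 - lam * γop) ^ 2))) * C4)) * ((r₁ x t)⁻¹ * (r₁ x y)⁻¹ * (r₁ x z)⁻¹ * (r₁ t y)⁻¹ * (r₁ t z)⁻¹ * (r₁ y z)⁻¹) : ℝ) := by
  have hΓ : (A * Aᵀ).PosSemidef := posSemidef_AAT A
  have hU₃c : Continuous U₃ := continuous_iff_continuousAt.2 fun φ => (hU₃d φ).continuousAt
  have hU₄c : Continuous U₄ := continuous_iff_continuousAt.2 fun φ => (hU₄d φ).continuousAt
  rw [(hasDerivAt_display4_kappa3A_line hΓ hΓop Y hUd hU'd hU''d hU₃c hκ₀ hκ₁ ha hτ hδ hθ0 hθ1 hκθ hstab hU'b hU''b hU₃b ψ (EuclideanSpace.single x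
        (1 : ℝ)) (EuclideanSpace.single y (1 : ℝ)) (EuclideanSpace.single z (1 : ℝ)) (EuclideanSpace.single t (1 : ℝ)) (EuclideanSpace.single s (1
        : ℝ))).deriv]
  have h1 := interpolated_hesshess_grad_entry hΓop Y hUd hU'd hU''d hU₃c hκ₀ hκ₁ ha hτ hδ hθ0 hθ1 hκθ hκθw hstab hU'b hU''b hU₃b hlam hUsec hρg hHk
        hHk0 hK3 ψ hK30 hαr hαc hhr hlamA hlamA1 hγ hγ1 hD hDC hθnn hDθr hdθ hDθc hdθ' hσ0 hσθ hρ1 hρsymm hρmul hρσ haσ hβ haσ' hgσ hgσ' hC3h x y z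
        t s
  have h2 := ((congrArg abs (cm3_swap12_pt _ _ _ _ _ _ _ _ _)).trans_le (interpolated_third_gradgrad_entry hΓop Y hUd hU'd hU''d hU₃d hU₄c hκ₀ hκ₁
        ha hτ hδ hθ0 hθ1 hκθ hκθw hstab hU'b hU''b hU₃b hU₄b hlam hUsec hρg hHk hHk0 hK4 ψ hK40 hαr hαc hhr hlamA hlamA1 hγ hγ1 hD hDC hθnn hDθr
        hdθ hDθc hdθ' hσ0 hσθ hρ1 hρsymm hρmul hρσ haσ hβ haσ' hkσ hkσ' hK3 hC3k x z t y s))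
  have h3 := ((congrArg abs (cm3_swap13_pt _ _ _ _ _ _ _ _ _)).trans_le (interpolated_hesshess_grad_entry hΓop Y hUd hU'd hU''d hU₃c hκ₀ hκ₁ ha hτ
        hδ hθ0 hθ1 hκθ hκθw hstab hU'b hU''b hU₃b hlam hUsec hρg hHk hHk0 hK3 ψ hK30 hαr hαc hhr hlamA hlamA1 hγ hγ1 hD hDC hθnn hDθr hdθ hDθc hdθ'
        hσ0 hσθ hρ1 hρsymm hρmul hρσ haσ hβ haσ' hgσ hgσ' hC3h x s z t y))
  have h4 := ((congrArg abs (u4_4213_pt _ _ _ _ _ _ _ _ _ _ _)).trans_le (interpolated_hess_fourth_cumulant_entry_two hΓop Y hUd hU'd hU''d hU₃c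
        hκ₀ hκ₁ ha hτ hδ hθ0 hθ1 hκθ hκθw hstab hU'b hU''b hU₃b hlam hUsec hρg hHk hHk0 hK3 hK30 ψ hαr hαc hhr hlamA hlamA1 hγ hγ1 hD hDC hθnn hDθr
        hdθ hDθc hdθ' hσ0 hσθ hr1 hrσ haσ hβ haσ' hgσ hgσ' hC4 hr₁1 hr₁symm hr₁mul hr₁8 hC40 x z t y s))
  have h5 := interpolated_hesshess_grad_entry hΓop Y hUd hU'd hU''d hU₃c hκ₀ hκ₁ ha hτ hδ hθ0 hθ1 hκθ hκθw hstab hU'b hU''b hU₃b hlam hUsec hρg hHk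
        hHk0 hK3 ψ hK30 hαr hαc hhr hlamA hlamA1 hγ hγ1 hD hDC hθnn hDθr hdθ hDθc hdθ' hσ0 hσθ hρ1 hρsymm hρmul hρσ haσ hβ haσ' hgσ hgσ' hC3h x y z
        s t
  have h6 := ((congrArg abs (cm3_swap12_pt _ _ _ _ _ _ _ _ _)).trans_le (interpolated_third_gradgrad_entry hΓop Y hUd hU'd hU''d hU₃d hU₄c hκ₀ hκ₁
        ha hτ hδ hθ0 hθ1 hκθ hκθw hstab hU'b hU''b hU₃b hU₄b hlam hUsec hρg hHk hHk0 hK4 ψ hK40 hαr hαc hhr hlamA hlamA1 hγ hγ1 hD hDC hθnn hDθr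
        hdθ hDθc hdθ' hσ0 hσθ hρ1 hρsymm hρmul hρσ haσ hβ haσ' hkσ hkσ' hK3 hC3k x z s y t))
  have h7 := ((congrArg abs (cm3_swap13_pt _ _ _ _ _ _ _ _ _)).trans_le (interpolated_hesshess_grad_entry hΓop Y hUd hU'd hU''d hU₃c hκ₀ hκ₁ ha hτ
        hδ hθ0 hθ1 hκθ hκθw hstab hU'b hU''b hU₃b hlam hUsec hρg hHk hHk0 hK3 ψ hK30 hαr hαc hhr hlamA hlamA1 hγ hγ1 hD hDC hθnn hDθr hdθ hDθc hdθ'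
        hσ0 hσθ hρ1 hρsymm hρmul hρσ haσ hβ haσ' hgσ hgσ' hC3h x t z s y))
  have h8 := ((congrArg abs (u4_4213_pt _ _ _ _ _ _ _ _ _ _ _)).trans_le (interpolated_hess_fourth_cumulant_entry_two hΓop Y hUd hU'd hU''d hU₃c
        hκ₀ hκ₁ ha hτ hδ hθ0 hθ1 hκθ hκθw hstab hU'b hU''b hU₃b hlam hUsec hρg hHk hHk0 hK3 hK30 ψ hαr hαc hhr hlamA hlamA1 hγ hγ1 hD hDC hθnn hDθr
        hdθ hDθc hdθ' hσ0 hσθ hr1 hrσ haσ hβ haσ' hgσ hgσ' hC4 hr₁1 hr₁symm hr₁mul hr₁8 hC40 x z s y t))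
  have h9 := interpolated_hesshess_grad_entry hΓop Y hUd hU'd hU''d hU₃c hκ₀ hκ₁ ha hτ hδ hθ0 hθ1 hκθ hκθw hstab hU'b hU''b hU₃b hlam hUsec hρg hHk
        hHk0 hK3 ψ hK30 hαr hαc hhr hlamA hlamA1 hγ hγ1 hD hDC hθnn hDθr hdθ hDθc hdθ' hσ0 hσθ hρ1 hρsymm hρmul hρσ haσ hβ haσ' hgσ hgσ' hC3h x y t
        s z
  have h10 := ((congrArg abs (cm3_swap12_pt _ _ _ _ _ _ _ _ _)).trans_le (interpolated_third_gradgrad_entry hΓop Y hUd hU'd hU''d hU₃d hU₄c hκ₀ hκ₁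
        ha hτ hδ hθ0 hθ1 hκθ hκθw hstab hU'b hU''b hU₃b hU₄b hlam hUsec hρg hHk hHk0 hK4 ψ hK40 hαr hαc hhr hlamA hlamA1 hγ hγ1 hD hDC hθnn hDθr
        hdθ hDθc hdθ' hσ0 hσθ hρ1 hρsymm hρmul hρσ haσ hβ haσ' hkσ hkσ' hK3 hC3k x t s y z))
  have h11 := ((congrArg abs (cm3_swap13_pt _ _ _ _ _ _ _ _ _)).trans_le (interpolated_hesshess_grad_entry hΓop Y hUd hU'd hU''d hU₃c hκ₀ hκ₁ ha hτ
        hδ hθ0 hθ1 hκθ hκθw hstab hU'b hU''b hU₃b hlam hUsec hρg hHk hHk0 hK3 ψ hK30 hαr hαc hhr hlamA hlamA1 hγ hγ1 hD hDC hθnn hDθr hdθ hDθc hdθ'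
        hσ0 hσθ hρ1 hρsymm hρmul hρσ haσ hβ haσ' hgσ hgσ' hC3h x z t s y))
  have h12 := ((congrArg abs (u4_4213_pt _ _ _ _ _ _ _ _ _ _ _)).trans_le (interpolated_hess_fourth_cumulant_entry_two hΓop Y hUd hU'd hU''d hU₃c
        hκ₀ hκ₁ ha hτ hδ hθ0 hθ1 hκθ hκθw hstab hU'b hU''b hU₃b hlam hUsec hρg hHk hHk0 hK3 hK30 ψ hαr hαc hhr hlamA hlamA1 hγ hγ1 hD hDC hθnn hDθr
        hdθ hDθc hdθ' hσ0 hσθ hr1 hrσ haσ hβ haσ' hgσ hgσ' hC4 hr₁1 hr₁symm hr₁mul hr₁8 hC40 x t s y z))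
  beta_reduce at h2 h3 h4 h6 h7 h8 h10 h11 h12
  exact (abs_split_kappa3 _ _ _ _ _ _ _ _ _ _ _ _ ).trans (add_le_add (add_le_add (add_le_add (add_le_add (add_le_add (add_le_add (add_le_add
        (add_le_add (add_le_add (add_le_add (add_le_add h1 h2) h3) h4) h5) h6) h7) h8) h9) h10) h11) h12)


/-! ## Toy -/

/-- Toy (the shape change): an indicator-supported bound `𝟙[X ≠ 0]·Q` and a homogeneous bound `c·X` interpolate to `√(cX·Q)`, which vanishes
with `X` and needs no support count: for `X = 0` the interpolated term is `0`. -/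
example (c Q : ℝ) : Real.sqrt (c * 0 * Q) = 0 := by simp

end Summit.QuantumFields.BalabanUV.T4Continuum.NE7b.SupInterpolatedFifthGroupFour

end
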